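import Summits.HodgeConjecture.CorCM.HypLiu418.A3Liu418PinBettiPinningOfLemma24Proj
import Summits.HodgeConjecture.CorCM.HypLiu418.A3Liu418EpsRigidAtFaceHolds
import Summits.HodgeConjecture.HodgeConjecture.Theorems.HCCMUnconditionalHD3
import Literature.NumberTheory.Automorphic.Liu2021.Lemma24OfJacobianDimension
import HarnessLib

/-!
# `HCCMUnconditional.HLiu418` modulo TWO named facts + (Lp) — rows III-11 and HD3 fed by their CLOSED tree terms

Topic: summit `HodgeConjecture`, sub-problem `HodgeConjecture`, route `HCCMUnconditional`, crux `HLiu418` (stmt-HodgeConjecture-24832).  PROVER FILE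
(cell hodgecm-mathlib; (G)-road lead A-p18 g2), THEOREMS ONLY, namespace `Summit.HodgeConjecture.CorCM.HypLiu418`.

The closing head `HLiu418_of_facts_of_lemma24Proj` (p614256, over C1 p613901) carries the projective ∕ (R-ℂ) shape (Lp) of [Liu2021, Lem. 2.4 (1)]
(`hLp`, = the head of the (G)-road file `Liu2021/Lemma24OfJacobianDimension.lean`) and THREE fact-level binders {VI-1 `hFal`, III-9′ `h415`,
III-11 `hε`} plus the route items `H21`, `H413`, `HD3`.  Two of these are now CLOSED TERMS of the tree:
* row III-11 — `Lines.A3Liu418.epsRigidAtFace_holds : EpsRigidAtFace` (A-p19 p619319, over 11a–11d);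
* item HD3 — `Theorems.HD3_proof : HCCMUnconditional.HD3` (A-p13 p613567).
Hence **`HLiu418_of_lemma24Proj_of_two_facts (hLp) (hFal) (h415) (h21) (h413) : HCCMUnconditional.HLiu418`**: modulo (Lp), hLiu418 ⇐ {VI-1, III-9′}
+ items `H21`, `H413`.  The (Lp)-free edition `HLiu418_of_two_facts` is appended to THIS file once `albanese_bettiOne_pullback_bijective_of_isProjectiveOver`
(A-p17, F6 over G1–G4ℂ + (R-bc)) is in the tree.  HC_CM is proved only modulo the 7 printed citations until rung 0 closes; this file discharges no
binder by itself (it shortens hLiu418's residual list to {III-0 in shape (Lp), VI-1, III-9′}).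

## References
* [Liu2021] Y. Liu, arXiv:2102.11518 = Camb. J. Math. 9 (2021): Thm. 4.18, Lem. 2.4 (1), Prop. 4.13, Thm. 4.15.
* [Faltings1983Endlichkeit] §5; [MurtyRamakrishnan1992] Prop. 6; [BushnellHenniart2006] §41.2 (2).
-/

set_option autoImplicit false

noncomputable section

namespace Summit.HodgeConjecture.CorCM.HypLiu418

open CategoryTheory CategoryTheory.Limits AlgebraicGeometry MonoidalCategory CartesianMonoidalCategory
open Literature.AlgebraicGeometry.Motives
open AbelianVariety (bcFunctor)
open Literature.AlgebraicGeometry.HodgeTheory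
open Literature.NumberTheory.Automorphic.Liu2021
open Literature.NumberTheory.Automorphic.Liu2021.AppendixC
open Summit.HodgeConjecture.CorCM.Lines.A3Liu418 (Thm415AtFace EpsRigidAtFace epsRigidAtFace_holds)
open Summit.HodgeConjecture.HodgeConjecture.Theorems (HD3_proof)

set_option synthInstance.maxHeartbeats 400000 in
set_option maxHeartbeats 8000000 in
/-- **CLOSING HEAD of item stmt-HodgeConjecture-24832 modulo (Lp) and EXACTLY TWO named facts** — `hFal` (row VI-1, [Fal83]) and `h415` (row III-9′,
[Liu21 Thm 4.15] = [MR92 Prop. 6] at the face) — plus the route items `H21`, `H413`: `HLiu418_of_facts_of_lemma24Proj` with `hε := epsRigidAtFace_holds`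
(row III-11 CLOSED, p619319) and `hD3 := Theorems.HD3_proof` (item HD3 CLOSED, p613567).  HC_CM is proved only modulo the 7 printed citations until
rung 0 closes. [cite: Liu2021, Thm. 4.18 (FJcycle.tex l. 2235–2290); Lem. 2.4 (1)] -/
theorem HLiu418_of_lemma24Proj_of_two_facts
    (hLp : ∀ {k : Type} [Field k] [CharZero k] [Algebra k ℂ] {d : ℕ} (X : SchemeOver k) [SmoothOfRelativeDimension d X.hom],
      IsProjectiveOver X → ∀ (a : Albanese X) (Ξ : Type) (Y : Ξ → SchemeOver ℂ) [∀ q, GeometricallyIrreducible (Y q).hom]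
        (inj : ∀ q, Y q ⟶ (bcFunctor k ℂ).obj X) (_ : IsColimit (Cofan.mk ((bcFunctor k ℂ).obj X) inj))
        {d' : ℕ} (_ : ∀ q, IsSmoothProjective d' (Y q))
        (_ : ∀ (q : Ξ) (𝒥 : Jacobian (Y q)), Module.finrank ℚ (bettiCohomology (Y q) 1) ≤ 2 * 𝒥.J.dim)
        (x : ∀ q, AlgPoints (Y q) ℂ) (ℓ : ∀ q, Y q ⊗ Y q ⟶ (bcFunctor k ℂ).obj a.nabla.N)
        (_ : ∀ q, ℓ q ≫ (bcFunctor k ℂ).map a.nabla.incl = (inj q ⊗ₘ inj q) ≫ Functor.LaxMonoidal.μ (bcFunctor k ℂ) X X)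
        (αx : (bcFunctor k ℂ).obj X ⟶ (a.Alb.baseChange ℂ).X)
        (_ : ∀ q, inj q ≫ αx = lift (𝟙 (Y q)) (toSpecOver (Y q) ≫ x q) ≫ ℓ q ≫ (bcFunctor k ℂ).map a.α),
        Function.Bijective (BettiUniverse.pull αx 1))
    (hFal : ∀ {K : Type} [Field K] (A B : AbelianVariety K) (ℓ : ℕ) [Fact ℓ.Prime], Literature.AlgebraicGeometry.Motives.faltings_tate_bijective A B ℓ)
    (h415 : Thm415AtFace)
    (h21 : Summit.HodgeConjecture.HodgeConjecture.Theses.HCCMUnconditional.H21) (h413 : Summit.HodgeConjecture.HodgeConjecture.Theses.HCCMUnconditional.H413) :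
    Summit.HodgeConjecture.HodgeConjecture.Theses.HCCMUnconditional.HLiu418 :=
  HLiu418_of_facts_of_lemma24Proj hLp hFal h415 epsRigidAtFace_holds h21 h413 HD3_proof

set_option synthInstance.maxHeartbeats 400000 in
set_option maxHeartbeats 8000000 in
/-- **CLOSING HEAD of item stmt-HodgeConjecture-24832 modulo EXACTLY TWO named facts — row III-0 ([Liu2021, Lem. 2.4 (1)]) DISCHARGED for the cone.**
`hFal` (row VI-1, [Fal83]) and `h415` (row III-9′, [Liu21 Thm 4.15] = [MR92 Prop. 6] at the face), plus the route items `H21`, `H413`: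
`HLiu418_of_lemma24Proj_of_two_facts` fed with the tree theorem `albanese_bettiOne_pullback_bijective_of_isProjectiveOver`
(`Liu2021/Lemma24OfJacobianDimension.lean`, the «(G)-road»: α-compatible finite-Galois Albanese fan G1–G4ℂ + Albanese dimension base change (R-bc)
+ (R-ℂ) for the pieces).  hLiu418 residual = {VI-1, III-9′} + items H21/H413.  HC_CM is proved only modulo the 7 printed citations until rung 0
closes. [cite: Liu2021, Thm. 4.18; Lem. 2.4 (1)] [cite: Grothendieck1962FGA6, Thm. 3.3 (iii)] -/
theorem HLiu418_of_two_facts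
    (hFal : ∀ {K : Type} [Field K] (A B : AbelianVariety K) (ℓ : ℕ) [Fact ℓ.Prime], Literature.AlgebraicGeometry.Motives.faltings_tate_bijective A B ℓ)
    (h415 : Thm415AtFace)
    (h21 : Summit.HodgeConjecture.HodgeConjecture.Theses.HCCMUnconditional.H21) (h413 : Summit.HodgeConjecture.HodgeConjecture.Theses.HCCMUnconditional.H413) :
    Summit.HodgeConjecture.HodgeConjecture.Theses.HCCMUnconditional.HLiu418 :=
  HLiu418_of_lemma24Proj_of_two_facts albanese_bettiOne_pullback_bijective_of_isProjectiveOver hFal h415 h21 h413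

end Summit.HodgeConjecture.CorCM.HypLiu418

end
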